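import Mathlib.Analysis.SpecificLimits.Basic
import Summits.Ventures.CertifiedArithmetic.LowPrec.GemmThetaLawE3M2Family
import Summits.Ventures.CertifiedArithmetic.LowPrec.GemmThetaLawGenE3M2Cert
import Summits.Ventures.CertifiedArithmetic.LowPrec.GemmThetaE3M2Bound
import HarnessLib

/-!
# GEMM worst case LX — `W_p(n)` for E3M2·E3M2 (FP6²) into EVERY precision `p ≥ 18`: the
# two-sided sandwich `θ_p/(n - 1 + θ_p(33/2 + κ_p)) ≤ 1 - W_p(n) ≤ θ_p/(n - c_p)` and the
# limit `n(1 - W_p(n)) → θ_p`, kernel-checked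

HONEST FRAMING: certified error envelopes and provably optimal rounding/accumulation schemes for
low-precision formats under stated cost models; every table by two implementations; no hardware or
vendor claims.

`W_φ(n)` (`worstRelErrE3M2 φ (n-1)`) is the largest relative error `|ŝ - s|/Σ|x_i|` of
sequential round-to-nearest-even accumulation in the format `φ` over ALL words of `n` letters
from the 291-letter product alphabet `Π(E3M2,E3M2) = piE3M2` (a finite maximum; at
`φ = bfloat16` literally the landed `worstRelErrE3M2BF16` of `GemmThetaE3M2Bound`).
For every format `φ` with `17 ≤ manBits φ` (`p ≥ 18`), `qexp φ ≤ -8` and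
`2^(manBits φ + 20) ≤ maxRat φ` (binary32, binary64, …), with the law's constants
`θ_p = e3m2Law.thetaL (manBits φ) = (6149·2^manBits + 12288)/65536`,
`κ_p = 65536/(6149·2^manBits + 12288) = 1/θ_p` (`e3m2Law_constants`) and `K = 2^(p-16)`
(`2^manBits = 32768K`, `θ_p = (98384K + 6)/32`):

* `worst8P_le` (SUP side, every `n`): `W_φ(n) ≤ 1 - θ_p/(n - 1 + θ_p(1 + 31/2 + κ_p))` —
  the generated law certificate `thetaCert_e3m2Law` (`GemmThetaLawGenE3M2Cert`) through
  `ThetaCertificate.abs_err_le` (`ρ = 29/6 ≤ β_pair = 31/2`);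
* `one_sub_worst8P_le` (the family of file LIX, every `n ≥ 507905K + 2`, every `p ≥ 16`):
  `1 - W_φ(n) ≤ (98384K + 6)/(32n - 15155192K + 3) = θ_p/(n - c_p)`,
  `c_p = (15155192K - 3)/32`;
* `worst8P_sandwich`: both at once — the E3M2 row of gemm.tex Thm. `t:thetap6` (iv) for every
  `p ≥ 18`, with onset `m_p = 507905K + 2 = 31·2^(p-2) + 2 + 2^(p-16)`;
* `worst8P_tendsto`: `n·(1 - W_φ(n)) → θ_p` (in `ℝ`, by the sandwich; Thm. `t:thetap6` (v));
* `worst8P_sandwich_Binary32`: the instance `p = 24` (`K = 256`) in integers —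
  `25186310/(32n + 415574115) ≤ 1 - W_24(n) ≤ 25186310/(32n - 3879729149)` for every
  `n ≥ 130023682` (the left side agrees with `abs_dot_err_le_e3m2_Binary32`; the common
  numerator is `32θ_24`, `θ_24 = 12593155/16`, because `κ_p θ_p = 1`).

What is NOT claimed: the exact value of `W_p(n)` between the two sides; `p ∈ {16, 17}` (the
family of file LIX is valid there, but the law certificate needs `p ≥ 18`); bfloat16 (`p = 8`,
settled for every `n` in `GemmThetaE3M2Bound`).  References: [Higham2002, §4.2],
[MullerEtAl2018HFPA, §6.1], [BoldoMelquiond2011Flocq]; [RouhaniEtAl2023MX, Table 1] (E3M2).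
-/

namespace Summit.Ventures.CertifiedArithmetic.LowPrec.Gemm

open Literature.ComputerArithmetic.FloatingPoint
open Literature.ComputerArithmetic.FloatingPoint.MiniFloat
open Literature.ComputerArithmetic.FloatingPoint.MiniFloat.ThetaLaw
open Literature.ComputerArithmetic.FloatingPoint.MiniFloat.ThetaE3M2 (lamG)
open Finset

/-! ### `W_φ(n)` over the product alphabet, any target format -/

/-- `W_φ(n)` for `n = m + 1`: the largest relative error of sequential RNE accumulation in `φ`
over all words of `n` letters from `Π(E3M2,E3M2)`. [cell, gemm.tex §Regimes] -/
def worstRelErrE3M2 (φ : Format) (m : ℕ) : ℚ :=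
  (univ : Finset (Fin (m + 1) → Fin 291)).sup' univ_nonempty
    (fun w => relErr φ (wordInputE3M2 w) m)

/-- At `bfloat16` this is literally the landed `worstRelErrE3M2BF16`. [cell, consistency] -/
theorem worstRelErrE3M2_BFloat16 (m : ℕ) :
    worstRelErrE3M2 Format.BFloat16 m = worstRelErrE3M2BF16 m := rfl

/-- Every input over the alphabet is dominated by `W_φ`. [folklore] -/
theorem relErr_le_worst8P (φ : Format) (x : ℕ → ℚ) (hx : ∀ j, x j ∈ piE3M2) (m : ℕ) :
    relErr φ x m ≤ worstRelErrE3M2 φ m := by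
  classical
  have hidx : ∀ j, ∃ i : Fin 291, ∀ h : i.val < piE3M2.length, piE3M2[i.val]'h = x j := by
    intro j
    obtain ⟨i, hi, h⟩ := List.getElem_of_mem (hx j)
    exact ⟨⟨i, by simpa [piE3M2_length] using hi⟩, fun _ => h⟩
  choose f hf using hidx
  have hxy : ∀ j ≤ m, x j = wordInputE3M2 (fun j : Fin (m + 1) => f j.val) j := by
    intro j hj
    unfold wordInputE3M2
    rw [dif_pos (by omega)]
    exact (hf j _).symm
  rw [relErr_congr φ hxy]
  exact le_sup' (fun w => relErr φ (wordInputE3M2 w) m) (mem_univ _)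

/-- The product table `lamG` of `GemmThetaE3M2Defs` and the law's alphabet `Λ` are the same
`291` integers (in another order): `lamG ⊆ Λ`. [cell, kernel] -/
theorem lamG_subset_lam_e3m2 : ∀ Q ∈ lamG, Q ∈ e3m2Law.lam := by decide +kernel

/-- … and `Λ ⊆ lamG`. [cell, kernel] -/
theorem lam_subset_lamG_e3m2 : ∀ Q ∈ e3m2Law.lam, Q ∈ lamG := by decide +kernel

/-- Letters of `Π(E3M2,E3M2)` are letters of the law. [cell] -/
theorem PiL_of_mem_piE3M2 {q : ℚ} (h : q ∈ piE3M2) : e3m2Law.PiL 8 q := by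
  obtain ⟨Q, hQ, rfl⟩ := exists_of_mem_piE3M2 h
  exact ⟨Q, lamG_subset_lam_e3m2 Q hQ, rfl⟩

/-- Every letter of the family of file LIX is in `Π(E3M2,E3M2)`. [cell] -/
theorem fam8_mem_pi (K k : ℕ) : fam8 K k ∈ piE3M2 := by
  have hm := (fam8Z_mem_pos K k).1
  unfold piE3M2
  exact List.mem_map.mpr ⟨fam8Z K k, lam_subset_lamG_e3m2 _ hm, by unfold fam8; norm_num⟩

/-! ### The law's constants for every precision -/

/-- THE CONSTANTS OF THE E3M2² LAW AT EVERY `m = manBits`: `θ = (6149·2^m + 12288)/65536`,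
`κ = 65536/(6149·2^m + 12288)`, `ρ = 29/6`, `β_pair = 31/2`. [cell, gemm.tex Thm. t:thetap6] -/
theorem e3m2Law_constants (mb : ℕ) :
    e3m2Law.thetaL mb = (6149 * 2 ^ mb + 12288) / 65536 ∧
    e3m2Law.kappaL mb = 65536 / (6149 * 2 ^ mb + 12288) ∧
    e3m2Law.rhoL = 29 / 6 ∧ e3m2Law.betaL = 31 / 2 := by
  have hB : e3m2Law.Bj 16 = 6149 := by decide
  have hS : e3m2Law.Sj 16 = 12288 := by decide
  simp only [LawData.thetaL, LawData.kappaL, LawData.rhoL, LawData.betaL,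
    show e3m2Law.kb = 16 from rfl, hB, hS, show e3m2Law.th1 = 6149 from rfl,
    show e3m2Law.th0 = 12288 from rfl, show e3m2Law.thD = 65536 from rfl,
    show e3m2Law.rhoN = 29 from rfl, show e3m2Law.rhoD = 6 from rfl,
    show e3m2Law.betaN = 31 from rfl, show e3m2Law.betaD = 2 from rfl]
  norm_num

/-- With `K = 2^(p-16)` (`2^manBits = 32768K`): `θ_p = (98384K + 6)/32`.
[gemm.tex Thm. t:thetap6] -/
theorem thetaL8_eq {φ : Format} {K : ℕ} (hM : 2 ^ φ.manBits = 32768 * K) :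
    e3m2Law.thetaL φ.manBits = (98384 * (K : ℚ) + 6) / 32 := by
  have hM' : ((2 ^ φ.manBits : ℕ) : ℚ) = ((32768 * K : ℕ) : ℚ) := by rw [hM]
  push_cast at hM'
  rw [(e3m2Law_constants φ.manBits).1, hM', div_eq_div_iff (by norm_num) (by norm_num)]
  ring

/-- `θ_p > 0`. [cell] -/
theorem thetaL8_pos (mb : ℕ) : 0 < e3m2Law.thetaL mb := by
  rw [(e3m2Law_constants mb).1]; positivity

/-- `κ_p ≥ 0`. [cell] -/
theorem kappaL8_nonneg (mb : ℕ) : 0 ≤ e3m2Law.kappaL mb := by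
  rw [(e3m2Law_constants mb).2.1]; positivity

/-! ### The sandwich -/

/-- SUP SIDE FOR EVERY `p ≥ 18` AND EVERY `n = m + 1` (kernel: the generated law certificate
`thetaCert_e3m2Law`): `W_φ(n) ≤ 1 - θ_p/(m + θ_p(1 + 31/2 + κ_p))`.
[cell, gemm.tex Thm. t:thetap6] -/
theorem worst8P_le (φ : Format) (hm : 17 ≤ φ.manBits) (hq : φ.qexp ≤ -8)
    (hR : (2 : ℚ) ^ (φ.manBits + 20) ≤ φ.maxRat) (m : ℕ) :
    worstRelErrE3M2 φ m ≤ 1 - e3m2Law.thetaL φ.manBits /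
      ((m : ℚ) + e3m2Law.thetaL φ.manBits * (1 + (31 / 2 + e3m2Law.kappaL φ.manBits))) := by
  have hθ := thetaL8_pos φ.manBits
  have hκ := kappaL8_nonneg φ.manBits
  apply sup'_le
  intro w _
  unfold relErr
  have hc : (0 : ℚ) ≤ 1 - e3m2Law.thetaL φ.manBits /
      ((m : ℚ) + e3m2Law.thetaL φ.manBits * (1 + (31 / 2 + e3m2Law.kappaL φ.manBits))) := by
    rw [sub_nonneg, div_le_one (by positivity)]
    nlinarith [show (0 : ℚ) ≤ m from Nat.cast_nonneg m]
  by_cases hL : ∑ j ∈ range (m + 1), |wordInputE3M2 w j| = 0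
  · rw [hL, div_zero]; exact hc
  · have hpos : 0 < ∑ j ∈ range (m + 1), |wordInputE3M2 w j| :=
      lt_of_le_of_ne (sum_nonneg fun i _ => abs_nonneg _) (Ne.symm hL)
    rw [div_le_iff₀ hpos]
    have h := (thetaCert_e3m2Law φ hm hq hR).abs_err_le (fun q hq' => PiL_neg _ _ hq') _
      (fun j => PiL_of_mem_piE3M2 (wordInputE3M2_mem w j)) m
    rw [(e3m2Law_constants φ.manBits).2.2.1, (e3m2Law_constants φ.manBits).2.2.2,
      max_eq_right (by norm_num : (29 / 6 : ℚ) ≤ 31 / 2)] at h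
    exact h

/-- THE FAMILY SIDE FOR EVERY `n = m + 1 ≥ 507905K + 2` (file LIX, `K = 2^(p-16)`, every
`p ≥ 16`): `1 - W_φ(n) ≤ (98384K + 6)/(32n - 15155192K + 3) = θ_p/(n - c_p)`.
[cell, gemm.tex Thm. t:thetap6] -/
theorem one_sub_worst8P_le (φ : Format) (hq : φ.qexp ≤ -8)
    (hR : (2 : ℚ) ^ (φ.manBits + 20) ≤ φ.maxRat) {K : ℕ} (hM : 2 ^ φ.manBits = 32768 * K)
    (m : ℕ) (hmK : 507905 * K + 1 ≤ m) :
    1 - worstRelErrE3M2 φ m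
      ≤ (98384 * (K : ℚ) + 6) / (32 * ((m : ℚ) + 1) - 15155192 * K + 3) := by
  have hw := relErr_le_worst8P φ (fam8 K) (fam8_mem_pi K) m
  have hd := fam8_defect hq hR hM m hmK
  unfold relErr at hw
  linarith

/-- THE TWO-SIDED SANDWICH FOR EVERY PRECISION `p ≥ 18` AND EVERY `n ≥ 507905·2^(p-16) + 2`
(`n = m + 1`, `K = 2^(p-16)`, `θ_p = (98384K + 6)/32`, `κ_p = 65536/(6149·2^manBits + 12288)`):
`θ_p/(m + θ_p(1 + 31/2 + κ_p)) ≤ 1 - W_p(n) ≤ θ_p/(n - (15155192K - 3)/32)`, both sides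
kernel-checked. [cell, gemm.tex Thm. t:thetap6 (iv)] -/
theorem worst8P_sandwich (φ : Format) (hm : 17 ≤ φ.manBits) (hq : φ.qexp ≤ -8)
    (hR : (2 : ℚ) ^ (φ.manBits + 20) ≤ φ.maxRat) {K : ℕ} (hM : 2 ^ φ.manBits = 32768 * K)
    (m : ℕ) (hmK : 507905 * K + 1 ≤ m) :
    e3m2Law.thetaL φ.manBits /
        ((m : ℚ) + e3m2Law.thetaL φ.manBits * (1 + (31 / 2 + e3m2Law.kappaL φ.manBits)))
        ≤ 1 - worstRelErrE3M2 φ m ∧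
      1 - worstRelErrE3M2 φ m
        ≤ e3m2Law.thetaL φ.manBits / ((m + 1 : ℚ) - (15155192 * K - 3) / 32) := by
  refine ⟨by linarith [worst8P_le φ hm hq hR m], ?_⟩
  have h := one_sub_worst8P_le φ hq hR hM m hmK
  have eB : (m + 1 : ℚ) - (15155192 * K - 3) / 32
      = (32 * ((m : ℚ) + 1) - 15155192 * K + 3) / 32 := by
    ring
  rw [thetaL8_eq hM, eB, div_div_div_cancel_right₀ (by norm_num : (32 : ℚ) ≠ 0)]
  exact h

/-- THE LIMIT, EVERY PRECISION `p ≥ 18`: `n · (1 - W_p(n)) → θ_p` as `n → ∞` (squeezed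
between the two sides of `worst8P_sandwich`). [cell, gemm.tex Thm. t:thetap6 (v)] -/
theorem worst8P_tendsto (φ : Format) (hm : 17 ≤ φ.manBits) (hq : φ.qexp ≤ -8)
    (hR : (2 : ℚ) ^ (φ.manBits + 20) ≤ φ.maxRat) :
    Filter.Tendsto (fun m : ℕ => ((m : ℝ) + 1) * (1 - (worstRelErrE3M2 φ m : ℝ)))
      Filter.atTop (nhds (e3m2Law.thetaL φ.manBits : ℝ)) := by
  obtain ⟨K, hM⟩ : ∃ K, 2 ^ φ.manBits = 32768 * K :=
    ⟨2 ^ (φ.manBits - 15), by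
      rw [show (32768 : ℕ) = 2 ^ 15 by norm_num, ← pow_add, Nat.add_sub_cancel' (by omega)]⟩
  set θ : ℝ := (e3m2Law.thetaL φ.manBits : ℝ) with hθdef
  set a : ℝ := θ * (1 + (31 / 2 + (e3m2Law.kappaL φ.manBits : ℝ))) - 1 with hadef
  set b : ℝ := (15155192 * (K : ℝ) - 3) / 32 with hbdef
  have hlim0 : Filter.Tendsto (fun m : ℕ => 1 / ((m : ℝ) + 1)) Filter.atTop (nhds 0) :=
    tendsto_one_div_add_atTop_nhds_zero_nat
  have hg : Filter.Tendsto (fun m : ℕ => θ / (1 + a * (1 / ((m : ℝ) + 1)))) Filter.atTop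
      (nhds θ) := by
    have h : Filter.Tendsto (fun m : ℕ => θ / (1 + a * (1 / ((m : ℝ) + 1)))) Filter.atTop
        (nhds (θ / (1 + a * 0))) :=
      tendsto_const_nhds.div (tendsto_const_nhds.add (tendsto_const_nhds.mul hlim0))
        (by norm_num)
    rw [mul_zero, add_zero, div_one] at h
    exact h
  have hh : Filter.Tendsto (fun m : ℕ => θ / (1 - b * (1 / ((m : ℝ) + 1)))) Filter.atTop
      (nhds θ) := by
    have h : Filter.Tendsto (fun m : ℕ => θ / (1 - b * (1 / ((m : ℝ) + 1)))) Filter.atTop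
        (nhds (θ / (1 - b * 0))) :=
      tendsto_const_nhds.div (tendsto_const_nhds.sub (tendsto_const_nhds.mul hlim0))
        (by norm_num)
    rw [mul_zero, sub_zero, div_one] at h
    exact h
  refine tendsto_of_tendsto_of_tendsto_of_le_of_le' hg hh ?_ ?_
  · refine Filter.eventually_atTop.2 ⟨507905 * K + 1, fun m hmK => ?_⟩
    have hr1 := (Rat.cast_le (K := ℝ)).mpr (worst8P_sandwich φ hm hq hR hM m hmK).1
    push_cast at hr1
    have hm0 : (0 : ℝ) < (m : ℝ) + 1 := by positivity
    have hm1 : (m : ℝ) + 1 ≠ 0 := hm0.ne'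
    have e1 : 1 + a * (1 / ((m : ℝ) + 1)) = (((m : ℝ) + 1) + a) / ((m : ℝ) + 1) := by
      rw [eq_div_iff hm1, add_mul, one_mul, mul_assoc, one_div_mul_cancel hm1, mul_one]
    have e2 : ((m : ℝ) + 1) + a
        = (m : ℝ) + θ * (1 + (31 / 2 + (e3m2Law.kappaL φ.manBits : ℝ))) := by
      rw [hadef]; ring
    show θ / (1 + a * (1 / ((m : ℝ) + 1))) ≤ ((m : ℝ) + 1) * (1 - (worstRelErrE3M2 φ m : ℝ))
    rw [e1, div_div_eq_mul_div, e2]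
    calc θ * ((m : ℝ) + 1) / ((m : ℝ) + θ * (1 + (31 / 2 + (e3m2Law.kappaL φ.manBits : ℝ))))
        = ((m : ℝ) + 1) *
            (θ / ((m : ℝ) + θ * (1 + (31 / 2 + (e3m2Law.kappaL φ.manBits : ℝ))))) := by ring
      _ ≤ ((m : ℝ) + 1) * (1 - (worstRelErrE3M2 φ m : ℝ)) :=
          mul_le_mul_of_nonneg_left hr1 hm0.le
  · refine Filter.eventually_atTop.2 ⟨507905 * K + 1, fun m hmK => ?_⟩
    have hr2 := (Rat.cast_le (K := ℝ)).mpr (worst8P_sandwich φ hm hq hR hM m hmK).2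
    push_cast at hr2
    have hm0 : (0 : ℝ) < (m : ℝ) + 1 := by positivity
    have hm1 : (m : ℝ) + 1 ≠ 0 := hm0.ne'
    have e1 : 1 - b * (1 / ((m : ℝ) + 1)) = (((m : ℝ) + 1) - b) / ((m : ℝ) + 1) := by
      rw [eq_div_iff hm1, sub_mul, one_mul, mul_assoc, one_div_mul_cancel hm1, mul_one]
    show ((m : ℝ) + 1) * (1 - (worstRelErrE3M2 φ m : ℝ))
      ≤ θ / (1 - b * (1 / ((m : ℝ) + 1)))
    rw [e1, div_div_eq_mul_div, hbdef]
    calc ((m : ℝ) + 1) * (1 - (worstRelErrE3M2 φ m : ℝ))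
        ≤ ((m : ℝ) + 1) * (θ / (((m : ℝ) + 1) - (15155192 * (K : ℝ) - 3) / 32)) :=
          mul_le_mul_of_nonneg_left hr2 hm0.le
      _ = θ * ((m : ℝ) + 1) / (((m : ℝ) + 1) - (15155192 * (K : ℝ) - 3) / 32) := by ring

/-! ### The instance `p = 24` (binary32) in integers -/

/-- binary32 meets the hypotheses, with `K = 2^8 = 256`. [cite: IEEE7542019, Table 3.5] -/
theorem Binary32_hyps8 : 17 ≤ Format.Binary32.manBits ∧ Format.Binary32.qexp ≤ -8 ∧
    (2 : ℚ) ^ (Format.Binary32.manBits + 20) ≤ Format.Binary32.maxRat ∧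
    2 ^ Format.Binary32.manBits = 32768 * 256 := by
  obtain ⟨h1, h2, h3⟩ := Binary32_hyps_e3m2
  exact ⟨by rw [h1]; norm_num, h2, h3, by rw [h1]; norm_num⟩

/-- E3M2·E3M2 INTO binary32, EVERY `n ≥ 130023682 = 507905·2^8 + 2`:
`25186310/(32n + 415574115) ≤ 1 - W_24(n) ≤ 25186310/(32n - 3879729149)` (`25186310 = 32θ_24`);
the left side holds for every `n` (the law's envelope `abs_dot_err_le_e3m2_Binary32`), the
right side is the family; `θ_24 = 12593155/16` and `n(1 - W_24(n)) → θ_24`.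
[cell, gemm.tex Thm. t:thetap6 at p = 24] -/
theorem worst8P_sandwich_Binary32 (m : ℕ) (hm : 130023681 ≤ m) :
    25186310 / (32 * ((m : ℚ) + 1) + 415574115)
        ≤ 1 - worstRelErrE3M2 Format.Binary32 m ∧
      1 - worstRelErrE3M2 Format.Binary32 m ≤ 25186310 / (32 * ((m : ℚ) + 1) - 3879729149) := by
  obtain ⟨h1, h2, h3, h4⟩ := Binary32_hyps8
  have h := worst8P_sandwich Format.Binary32 h1 h2 h3 h4 m (by omega)
  rw [Binary32_hyps_e3m2.1, lawConstants_e3m2_Binary32.1, lawConstants_e3m2_Binary32.2.1] at h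
  have hm' : (130023681 : ℚ) ≤ m := by exact_mod_cast hm
  have e1 : (12593155 / 16 : ℚ) / ((m : ℚ) + 12593155 / 16 * (1 + (31 / 2 + 16 / 12593155)))
      = 25186310 / (32 * ((m : ℚ) + 1) + 415574115) := by
    rw [div_eq_div_iff (by positivity) (by positivity)]; ring
  have e2 : (12593155 / 16 : ℚ) / ((m + 1 : ℚ) - (15155192 * ((256 : ℕ) : ℚ) - 3) / 32)
      = 25186310 / (32 * ((m : ℚ) + 1) - 3879729149) := by
    rw [div_eq_div_iff (ne_of_gt (by push_cast; linarith)) (ne_of_gt (by linarith))]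
    push_cast; ring
  rw [e1, e2] at h
  exact h

end Summit.Ventures.CertifiedArithmetic.LowPrec.Gemm
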